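import Literature.MathematicalPhysics.QuantumFieldTheory.Balaban1983to89.B9Eq346GradGpDivAtPinsL2
import Literature.MathematicalPhysics.QuantumFieldTheory.Balaban1983to89.B9Eq346GradGpDivTorusL2Par

/-!
# `Balaban1983to89.B9Eq346GradGpDivAtPinsL2Par` — T. Bałaban, *Propagators for lattice gauge theories in a background field*, Commun. Math. Phys. **99** (1985) 389–434
# [Balaban1985BackgroundPropagators] Thm 3.1 (3.46) p. 398 (order-zero entry `∇_UG′(U)∇*_U`, block localised, `e^{−δ₀d(y,y′)}`), with [Balaban1984PropagatorsII] (2.46),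
# (2.51)–(2.54), Lemma 2.1: ★★ **(3.46)₄ FOR THE COMPOSITE LETTER `DvcoKH ∘ GcoS(G′(par)) ∘ DvscoKH` OVER `blkBK bI` AT A GENERIC SITE TRANSPORTER FROM THE THREE TRANSPORTER
# LAWS — member-uniform constants** — n06-d's `B9Eq346GradGpDivAtPinsL2` §3 re-pressed over `par` (link 6 of the CASCADE-K re-press of the (3.46)₄ chain; links 1–5 =
# `B9Thm31Site{GpDecay,AgmonWeight,GpGradDecay,GradGpDivDecay}Par`, `B9Eq346GradGpDivTorusL2Par`)

statement-level skeleton of published theorems with citation tags; proofs where landed; nothing here is a claim about the Yang–Mills mass gap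

WHY THIS FILE.  `B9Eq346GradGpDivAtPinsL2` turns the torus-block HS estimate for `gradY U ∘ GpY (parSymY) U ∘ divY U` into the certificate's block-`L²` bound
`BlockBd (toB6 (geo9K i) R₀ H₀) (blkBK bI) (blkBK bI) (DvcoKH … ∘ₗ GcoS … (GpY i (parSymY i)) … ∘ₗ DvscoKH …) (B₄·e^{−δ₄·dist})` with constants `M₄, B₄, δ₄` on `d, ℓ, N` only
(its `DvcoKH_GcoS_DvscoKH_eq`, `blockBd_smul_of_nonneg'` and the `…CoordsL2` engine are transporter-free — reused BY NAME).  THIS FILE does the same at ANY site transporter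
`par` whose legs at the configuration are `G`-valued and inverse-symmetric and whose `Δ′_a(U; par)` has a level-weighted coercivity constant `κ₀ ∈ (0, 1∕8]`; the Agmon rate is
fixed inside as `δ := κ₀∕(d+2)` (admissible: `δ ≤ 1`, `δ(d+1) ≤ 1`, `δ²(2(d+1)+(d+1)²) ≤ κ₀² ≤ κ₀∕2`), so the constants depend on `d, ℓ, N, κ₀` only:
★ `blockBd_torus_coordOpKH_gradY_GpY_divY_par` (torus level, rate `δ` a parameter), ★★ `blockBd_DvGcoSDvs_kIdx_par` (every k-level index above one threshold, every letter
family `cfg`, every `par`), ★★★ `blockBd_DvGcoSDvs_memberY_par` (at a member of the N06 certificate).  The knit instance (`par := parKnitY`, `κ₀ = 1∕32` on (3.35)) is the sequel.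
HONEST SCOPE.  Block-`L²` bounds for one finite lattice operator at a time, laws displayed; NOT a node discharge; count-neutral; nothing continuum ∕ OS ∕ mass gap ∕ Clay.
Cell `pub-ymgap` (D-0062), Track A node N06 [B9], seat `pub-ymgap-dag-n06-l` (g37), 2026-08-30; NEW file; nothing landed is modified.
-/

noncomputable section

namespace Literature.MathematicalPhysics.QuantumFieldTheory.Balaban1983to89.B9Eq346GradGpDivAtPinsL2Par

open Literature.MathematicalPhysics.QuantumFieldTheory.Balaban1983to89
open Node00 B6KLevelCensusIndexV1 B6Geom246MultiLevelBox B6MultiLevelTorusOperator B6GlobalChartV1 B9BackgroundsKLevelV1 B9Thm311ReadingCoords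
  B6Geom246MultiLevelTorus B9Eq346GradGpDivTorusL2 B9Eq346GradGpDivCoordsL2 B9Eq346GradGpDivAtPinsL2 B9Eq346GradGpDivTorusL2Par
open Literature.MathematicalPhysics.QuantumFieldTheory.Balaban1983to89.B6Ineq2142KLevelV1 (lvl β)
open Literature.MathematicalPhysics.QuantumFieldTheory.Balaban1983to89.B9Thm314GpFlatMultiLevelTorus (consts_260_261)
open Literature.MathematicalPhysics.QuantumFieldTheory.Balaban1983to89.B6Lemma21Repaired (Ineq261With)
open Literature.MathematicalPhysics.QuantumFieldTheory.Balaban1983to89.B9GeoNormsKLevelV1 (geo9K)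
open Literature.MathematicalPhysics.QuantumFieldTheory.Balaban1983to89.B9GeoLemma21KLevelV1 (one_le_Mh)
open Literature.MathematicalPhysics.QuantumFieldTheory.Balaban1983to89.B9Ineq349SiteComposite (etaS_pos)
open Literature.MathematicalPhysics.QuantumFieldTheory.Balaban1983to89.B9Thm39ReadingCoords (cR39 cR39_nonneg)
open Literature.MathematicalPhysics.QuantumFieldTheory.Balaban1983to89.B9CoReadingCoords (XBK blkBK)
open Literature.MathematicalPhysics.QuantumFieldTheory.Balaban1983to89.B9CoReadingCoordsH (coordOpKH)
open Literature.MathematicalPhysics.QuantumFieldTheory.Balaban1983to89.B9CoReadingCoordsS (XSK GcoS)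
open Literature.MathematicalPhysics.QuantumFieldTheory.Balaban1983to89.B9CoReadingCoordsTranspose (TrIdx trBasis)
open Literature.MathematicalPhysics.QuantumFieldTheory.Balaban1983to89.B9Thm34Ext (toB6)
open Literature.MathematicalPhysics.QuantumFieldTheory.Balaban1983to89.B9SectDL2Decay (bl2 BlockBd)
open Literature.MathematicalPhysics.QuantumFieldTheory.Balaban1983to89.B9PinMembersKLevelV1 (MemberY geo9Y bg9Y reg335Y_iff)
open Literature.MathematicalPhysics.QuantumFieldTheory.Balaban1983to89.Node00.OpsYSectDCoords (coordOpKH_comp_coordOpKH DvcoKH DvscoKH)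
open Literature.MathematicalPhysics.QuantumFieldTheory.Balaban1983to89.Node00.OpsYNablaBridge (cf_mul_etaS_of_hcfk)
open scoped Matrix Matrix.Norms.L2Operator

variable {d ℓ : ℕ} {hd : 1 ≤ d + 1} {hL : Odd (ℓ + 1) ∧ 1 < ℓ + 1} {b₀ b₁ : ℝ}

section AtPins

variable (i : KIdx d ℓ hd hL b₀ b₁) {N : ℕ} {G : Subgroup (Matrix (Fin N) (Fin N) ℂ)ˣ} (par : SiteParY (Matrix (Fin N) (Fin N) ℂ) i)

/-- ★ the torus-level block bound of the mixed coordinate model of `D_U G′(U; par) D\*_U` from link 5's HS estimate (laws: `U` `G`-valued, legs `par U z w ∈ G` inverse-symmetric,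
coercivity `κ₀ ∈ (0, 1∕8]`; rate `δ` with `0 ≤ δ ≤ 1`, `δ(d+1) ≤ 1`, `δ²(2(d+1)+(d+1)²) ≤ κ₀∕2`), kernel `C₁·e^{−δ₁d_T}` with `C₁ = c_f²·√(10(d+1))·e^{δ(1 + 1∕(2L))}`, `δ₁ = δ∕(2L)`.
[cite: Balaban1985BackgroundPropagators, Thm 3.1 (3.46) p.398; Balaban1984PropagatorsII, (2.46) p.231, (2.54) p.233; Agmon1982, Ch.1, Thm 1.5] -/
theorem blockBd_torus_coordOpKH_gradY_GpY_divY_par [Nonempty (Fin N)] (hG : G ≤ B7Prop2Explicit.unitaryUnits (Matrix (Fin N) (Fin N) ℂ))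
    {U : CfgY (Matrix (Fin N) (Fin N) ℂ) i} (hU : ∀ μ x, U μ x ∈ G) (hpar : ∀ z w : SiteY i, par U z w ∈ G)
    (hinv : ∀ z z' : SiteY i, par U z z' = (par U z' z)⁻¹) {κ₀ : ℝ} (hκ₀ : 0 < κ₀) (hκ₀1 : κ₀ ≤ 1 / 8)
    (hcoer : ∀ Φ : SiteY i → Matrix (Fin N) (Fin N) ℂ,
      κ₀ * ∑ z : SiteY i, (((((ℓ + 1) ^ (blkOf i.D.toDomains z).1.1 : ℕ) : ℝ)) ^ 2)⁻¹ * ∑ a, ∑ b, ‖Φ z a b‖ ^ 2 ≤ trIP (fun _ => (1 : ℝ)) Φ (deltaPrimeAY i par U Φ))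
    {δ : ℝ} (hδ0 : 0 ≤ δ) (hδ1 : δ ≤ 1) (hδD : δ * ((d : ℝ) + 1) ≤ 1) (hδκ : δ ^ 2 * (2 * ((d : ℝ) + 1) + ((d : ℝ) + 1) ^ 2) ≤ κ₀ / 2) :
    BlockBd (g := geomT i.D) (fun p : XBK (TrIdx N) i => blkV1 i.hN i.D p.1) (fun p : XBK (TrIdx N) i => blkV1 i.hN i.D p.1)
      (coordOpKH (trBasis N) (fun _ : Fin (d + 1) => (gradY i U ∘ₗ GpY i par U ∘ₗ divY i U).restrictScalars ℝ))
      (fun t s => i.cf ^ 2 * Real.sqrt (10 * ((d : ℝ) + 1)) * Real.exp (δ * (1 + 1 / (2 * ((ℓ + 1 : ℕ) : ℝ))))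
        * Real.exp (-(δ / (2 * ((ℓ + 1 : ℕ) : ℝ)) * (geomT i.D).dist t s))) := by
  set L2 : ℝ := 2 * ((ℓ + 1 : ℕ) : ℝ) with hL2
  have hL2pos : 0 < L2 := by rw [hL2]; positivity
  have hK : BlockBd (g := geomT i.D) (fun p : XBK (TrIdx N) i => blkV1 i.hN i.D p.1) (fun p : XBK (TrIdx N) i => blkV1 i.hN i.D p.1)
      (coordOpKH (trBasis N) (fun _ : Fin (d + 1) => (gradY i U ∘ₗ GpY i par U ∘ₗ divY i U).restrictScalars ℝ))
      (fun t s => i.cf ^ 2 * Real.sqrt (10 * ((d : ℝ) + 1)) * (Real.exp (δ * (((((bondT i.D).dist t s : ℝ)) - 1) / L2 - 1)))⁻¹) := by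
    refine blockBd_fst_coordOpKH_of_hs (fun t s => by positivity) fun Λ t s hΛ => ?_
    have h := hs_block_gradY_GpY_divY_le_par i par hG (U := U) hU hpar hinv hκ₀ hκ₀1 hcoer hδ0 hδ1 hδD hδκ s t hΛ
    have hK2 : (i.cf ^ 2 * Real.sqrt (10 * ((d : ℝ) + 1)) * (Real.exp (δ * (((((bondT i.D).dist t s : ℝ)) - 1) / L2 - 1)))⁻¹) ^ 2
        = i.cf ^ 4 * (10 * ((d : ℝ) + 1)) / Real.exp (δ * (((((bondT i.D).dist t s : ℝ)) - 1) / L2 - 1)) ^ 2 := by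
      rw [mul_pow, mul_pow, Real.sq_sqrt (by positivity), inv_pow]
      ring
    rw [hK2]
    convert h using 3
    all_goals rfl
  refine hK.mono fun t s => le_of_eq ?_
  have hdist : (geomT i.D).dist t s = (((bondT i.D).dist t s : ℝ)) := rfl
  rw [hdist, ← Real.exp_neg, mul_assoc (i.cf ^ 2 * Real.sqrt (10 * ((d : ℝ) + 1))), ← Real.exp_add]
  congr 2
  rw [hL2]
  field_simp
  ring

end AtPins

/-- the Agmon rate `δ := κ₀∕(d+2)` is admissible for `0 < κ₀ ≤ 1∕8`: `0 ≤ δ ≤ 1`, `δ(d+1) ≤ 1`, `δ²(2(d+1) + (d+1)²) ≤ κ₀∕2`. [cite: Agmon1982, Ch.1, bookkeeping] -/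
theorem agmonRate_admissible (d : ℕ) {κ₀ : ℝ} (hκ₀ : 0 < κ₀) (hκ₀1 : κ₀ ≤ 1 / 8) :
    0 ≤ κ₀ / ((d : ℝ) + 2) ∧ κ₀ / ((d : ℝ) + 2) ≤ 1 ∧ κ₀ / ((d : ℝ) + 2) * ((d : ℝ) + 1) ≤ 1 ∧
      (κ₀ / ((d : ℝ) + 2)) ^ 2 * (2 * ((d : ℝ) + 1) + ((d : ℝ) + 1) ^ 2) ≤ κ₀ / 2 := by
  have hd0 : (0 : ℝ) ≤ d := Nat.cast_nonneg d
  have hd2 : (0 : ℝ) < (d : ℝ) + 2 := by positivity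
  refine ⟨by positivity, ?_, ?_, ?_⟩
  · rw [div_le_one hd2]; linarith
  · rw [div_mul_eq_mul_div, div_le_one hd2]; nlinarith
  · rw [div_pow, div_mul_eq_mul_div, div_le_iff₀ (by positivity)]
    have h1 : 2 * ((d : ℝ) + 1) + ((d : ℝ) + 1) ^ 2 ≤ ((d : ℝ) + 2) ^ 2 := by nlinarith
    have h2 : κ₀ ^ 2 ≤ κ₀ / 2 * 1 := by nlinarith
    calc κ₀ ^ 2 * (2 * ((d : ℝ) + 1) + ((d : ℝ) + 1) ^ 2) ≤ κ₀ ^ 2 * ((d : ℝ) + 2) ^ 2 := mul_le_mul_of_nonneg_left h1 (sq_nonneg _)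
      _ ≤ κ₀ / 2 * ((d : ℝ) + 2) ^ 2 := mul_le_mul_of_nonneg_right (by nlinarith) (sq_nonneg _)

/-- ★★ **(3.46)₄ FOR THE CERTIFICATE's COMPOSITE LETTER OVER `blkBK bI` AT A GENERIC TRANSPORTER, UNIFORMLY ON THE k-LEVEL CENSUS**: for `0 < κ₀ ≤ 1∕8` there are `M₄, B₄, δ₄ > 0`
(on `d, ℓ, N, κ₀`) such that for every index `i` with `M₄ ≤ M` and `c_f = L^k`, every `G ≤ U(N)` (`N ≥ 1`), every letter family `cfg`, every site transporter `par` and every `U₁`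
whose configuration `cfg U₁` is `G`-valued with `G`-valued inverse-symmetric legs `par (cfg U₁) z w` and coercivity `κ₀` of `Δ′_a(cfg U₁; par)`, every level-∕1-faithful `bI`, `R₀, H₀`:
`BlockBd (toB6 (geo9K i) R₀ H₀) (blkBK bI) (blkBK bI) (DvcoKH … U₁ ∘ₗ GcoS … (GpY i par) U₁ ∘ₗ DvscoKH … U₁) (B₄·e^{−δ₄·dist})`.
[cite: Balaban1985BackgroundPropagators, Thm 3.1 (3.46)–(3.47) p.398, p.397; Balaban1984PropagatorsII, (2.46) p.231, (2.51)–(2.54) pp.232–233, Lemma 2.1 (2.61) p.234; Agmon1982, Ch.1, Thm 1.5] -/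
theorem blockBd_DvGcoSDvs_kIdx_par (d ℓ : ℕ) (hd : 1 ≤ d + 1) (hL : Odd (ℓ + 1) ∧ 1 < ℓ + 1) (b₀ b₁ : ℝ) (N : ℕ) {κ₀ : ℝ} (hκ₀ : 0 < κ₀) (hκ₀1 : κ₀ ≤ 1 / 8) :
    ∃ M₄ B₄ δ₄ : ℝ, 0 < M₄ ∧ 0 < B₄ ∧ 0 < δ₄ ∧
      ∀ (i : KIdx d ℓ hd hL b₀ b₁), M₄ ≤ (geo9K i).M → i.cf = (((ℓ + 1 : ℕ) : ℝ)) ^ i.k →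
      ∀ {G : Subgroup (Matrix (Fin N) (Fin N) ℂ)ˣ} (_ : G ≤ B7Prop2Explicit.unitaryUnits (Matrix (Fin N) (Fin N) ℂ)) [Nonempty (Fin N)]
        (B : B9.Backgrounds) (cfg : B.Cfg → CfgY (Matrix (Fin N) (Fin N) ℂ) i) (par : SiteParY (Matrix (Fin N) (Fin N) ℂ) i) (U₁ : B.Cfg)
        (_ : ∀ μ x, cfg U₁ μ x ∈ G) (_ : ∀ z w : SiteY i, par (cfg U₁) z w ∈ G) (_ : ∀ z z' : SiteY i, par (cfg U₁) z z' = (par (cfg U₁) z' z)⁻¹)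
        (_ : ∀ Φ : SiteY i → Matrix (Fin N) (Fin N) ℂ,
          κ₀ * ∑ z : SiteY i, (((((ℓ + 1) ^ (blkOf i.D.toDomains z).1.1 : ℕ) : ℝ)) ^ 2)⁻¹ * ∑ a, ∑ b, ‖Φ z a b‖ ^ 2
            ≤ trIP (fun _ => (1 : ℝ)) Φ (deltaPrimeAY i par (cfg U₁) Φ))
        {bI : FBondY i → IBondY i} (_ : ∀ f : FBondY i, lvl i.hN i.D i.hk (bI f) = (blkV1 i.hN i.D f).1.1)
        (_ : ∀ f : FBondY i, (geomT i.D).dist (β i.hN i.D i.hk (bI f)) (blkV1 i.hN i.D f) ≤ 1) (R₀ : ℝ) (H₀ : Prop) [Fintype (geo9K i).Site],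
        BlockBd (g := toB6 (geo9K i) R₀ H₀) (blkBK (κ := TrIdx N) i bI) (blkBK (κ := TrIdx N) i bI)
          (DvcoKH i (trBasis N) B cfg U₁ ∘ₗ (GcoS i (trBasis N) B cfg (GpY i par) U₁ ∘ₗ DvscoKH i (trBasis N) B cfg U₁))
          (fun a a' => B₄ * Real.exp (-(δ₄ * (geo9K i).dist a a'))) := by
  set δ : ℝ := κ₀ / ((d : ℝ) + 2) with hδ
  obtain ⟨hδ0, hδ1, hδD, hδκ⟩ := agmonRate_admissible d hκ₀ hκ₀1
  set δ₁ : ℝ := δ / (2 * ((ℓ + 1 : ℕ) : ℝ)) with hδ₁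
  have hδpos : 0 < δ := by rw [hδ]; positivity
  have hδ₁pos : 0 < δ₁ := by rw [hδ₁]; positivity
  obtain ⟨N₁, c, -, hc0, hcon⟩ := consts_260_261 d ℓ hδ₁pos
  set C₀ : ℝ := Real.sqrt (10 * ((d : ℝ) + 1)) * Real.exp (δ * (1 + 1 / (2 * ((ℓ + 1 : ℕ) : ℝ)))) with hC₀
  set B₄ : ℝ := max (cR39 (trBasis N) * C₀ * c * Real.exp (3 / 2 * δ₁) * Real.sqrt (Real.exp (1 / 4 * δ₁) * c)) 1 with hB₄
  refine ⟨(N₁ : ℝ) + 1, B₄, 3 / 4 * δ₁, by positivity, lt_of_lt_of_le one_pos (le_max_right _ _), by positivity, ?_⟩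
  intro i hM hcf G hG _ B cfg par U₁ hU hpar hinv hcoer bI hlev hβ1 R₀ H₀ _
  have hLcast : (((ℓ + 1 : ℕ) : ℝ)) = (ℓ : ℝ) + 1 := by push_cast; ring
  have hMdef : (geo9K i).M = (((ℓ + 1 : ℕ) : ℝ)) * (i.Mh : ℝ) := rfl
  have hN : (N₁ : ℝ) + 1 ≤ ((ℓ : ℝ) + 1) * i.Mh := by rw [← hLcast, ← hMdef]; exact hM
  have hR1 : 1 ≤ i.R := le_trans (by omega) (toKT i).hR
  have hRN : N₁ + 1 ≤ i.R * ((ℓ + 1) * i.Mh) := by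
    have h2 : N₁ + 1 ≤ (ℓ + 1) * i.Mh := by exact_mod_cast hN
    calc N₁ + 1 ≤ 1 * ((ℓ + 1) * i.Mh) := by rw [one_mul]; exact h2
      _ ≤ i.R * ((ℓ + 1) * i.Mh) := Nat.mul_le_mul_right _ hR1
  obtain ⟨-, h261⟩ := hcon i.k i.Mh i.R i.P' (one_le_Mh i) (toKT i).hP hRN
  have h261D : Ineq261With c (geomT i.D) δ₁ (1 / 4) := h261 i.D
  have hT := blockBd_torus_coordOpKH_gradY_GpY_divY_par i par hG (U := cfg U₁) hU hpar hinv hκ₀ hκ₀1 hcoer hδ0 hδ1 hδD hδκ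
  have hC₁ : 0 ≤ i.cf ^ 2 * Real.sqrt (10 * ((d : ℝ) + 1)) * Real.exp (δ * (1 + 1 / (2 * ((ℓ + 1 : ℕ) : ℝ)))) := by positivity
  have hre := blockBd_pull_bI_of_blockBd_torus i (X := XBK (TrIdx N) i) Prod.fst hlev hβ1 hC₁ hδ₁pos.le hT h261D R₀ H₀
  have hs0 : 0 ≤ etaS i ^ 2 * cR39 (trBasis N) := mul_nonneg (sq_nonneg _) (cR39_nonneg _)
  have hsm := blockBd_smul_of_nonneg' hre hs0
  rw [← DvcoKH_GcoS_DvscoKH_eq i (trBasis N) B cfg (GpY i par) U₁] at hsm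
  refine hsm.mono fun a a' => ?_
  have hunit : etaS i ^ 2 * i.cf ^ 2 = 1 := by rw [← mul_pow, mul_comm, cf_mul_etaS_of_hcfk i hcf, one_pow]
  have hle : cR39 (trBasis N) * C₀ * c * Real.exp (3 / 2 * δ₁) * Real.sqrt (Real.exp (1 / 4 * δ₁) * c) ≤ B₄ := le_max_left _ _
  have hexp0 : 0 ≤ Real.exp (-(3 / 4 * δ₁ * (geo9K i).dist a a')) := (Real.exp_pos _).le
  calc etaS i ^ 2 * cR39 (trBasis N) * (i.cf ^ 2 * Real.sqrt (10 * ((d : ℝ) + 1)) * Real.exp (δ * (1 + 1 / (2 * ((ℓ + 1 : ℕ) : ℝ))))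
          * c * Real.exp (3 / 2 * δ₁) * Real.sqrt (Real.exp (1 / 4 * δ₁) * c) * Real.exp (-(3 / 4 * δ₁ * (geo9K i).dist a a')))
      = (etaS i ^ 2 * i.cf ^ 2) * (cR39 (trBasis N) * C₀ * c * Real.exp (3 / 2 * δ₁) * Real.sqrt (Real.exp (1 / 4 * δ₁) * c))
          * Real.exp (-(3 / 4 * δ₁ * (geo9K i).dist a a')) := by rw [hC₀]; ring
    _ ≤ B₄ * Real.exp (-(3 / 4 * δ₁ * (geo9K i).dist a a')) := by
        rw [hunit, one_mul]
        exact mul_le_mul_of_nonneg_right hle hexp0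

/-- ★★★ **(3.46)₄ AT A MEMBER OF THE N06 CERTIFICATE, GENERIC TRANSPORTER**: for `0 < κ₀ ≤ 1∕8` there are `M₄, B₄, δ₄ > 0` (on `d, ℓ, N, κ₀`) such that for `x : MemberY` above the
threshold, `G ≤ U(N)` (`N ≥ 1`), every site transporter `par` and every configuration `U` of the member that is `G`-valued with `G`-valued inverse-symmetric legs `par U z w` and
coercivity `κ₀` of `Δ′_a(U; par)`, and the certificate's level-∕1-faithful `bI`:
`BlockBd (toB6 (geo9Y x) R₀ H₀) (blkBK x.toKIdx bI) (blkBK x.toKIdx bI) (DvcoKH … U ∘ₗ GcoS … (GpY x.toKIdx par) U ∘ₗ DvscoKH … U) (B₄·e^{−δ₄·(geo9Y x).dist})`.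
[cite: Balaban1985BackgroundPropagators, Thm 3.1 (3.46)–(3.47) p.398, p.397; Balaban1984PropagatorsII, (2.46) p.231, (2.51)–(2.54) pp.232–233, Lemma 2.1 (2.61) p.234; Agmon1982, Ch.1, Thm 1.5] -/
theorem blockBd_DvGcoSDvs_memberY_par (d ℓ : ℕ) (hd : 1 ≤ d + 1) (hL : Odd (ℓ + 1) ∧ 1 < ℓ + 1) (b₀ b₁ : ℝ) (Mstar : ℕ) (N : ℕ) [NeZero N]
    {κ₀ : ℝ} (hκ₀ : 0 < κ₀) (hκ₀1 : κ₀ ≤ 1 / 8) :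
    ∃ M₄ B₄ δ₄ : ℝ, 0 < M₄ ∧ 0 < B₄ ∧ 0 < δ₄ ∧
      ∀ {G : Subgroup (Matrix (Fin N) (Fin N) ℂ)ˣ} (_ : G ≤ B7Prop2Explicit.unitaryUnits (Matrix (Fin N) (Fin N) ℂ))
        (x : MemberY d ℓ hd hL b₀ b₁ Mstar), M₄ ≤ (geo9Y x).M →
      ∀ (par : SiteParY (Matrix (Fin N) (Fin N) ℂ) x.toKIdx) (U : (bg9Y (Matrix (Fin N) (Fin N) ℂ) G x).Cfg),
        (∀ μ y, U μ y ∈ G) → (∀ z w : SiteY x.toKIdx, par U z w ∈ G) → (∀ z z' : SiteY x.toKIdx, par U z z' = (par U z' z)⁻¹) →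
        (∀ Φ : SiteY x.toKIdx → Matrix (Fin N) (Fin N) ℂ,
          κ₀ * ∑ z : SiteY x.toKIdx, (((((ℓ + 1) ^ (blkOf x.D.toDomains z).1.1 : ℕ) : ℝ)) ^ 2)⁻¹ * ∑ a, ∑ b, ‖Φ z a b‖ ^ 2
            ≤ trIP (fun _ => (1 : ℝ)) Φ (deltaPrimeAY x.toKIdx par U Φ)) →
      ∀ {bI : FBondY x.toKIdx → IBondY x.toKIdx} (_ : ∀ f, lvl x.hN x.D x.hk (bI f) = (blkV1 x.hN x.D f).1.1)
        (_ : ∀ f, (geomT x.D).dist (β x.hN x.D x.hk (bI f)) (blkV1 x.hN x.D f) ≤ 1) (R₀ : ℝ) (H₀ : Prop) [Fintype (geo9Y x).Site],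
        BlockBd (g := toB6 (geo9Y x) R₀ H₀) (blkBK (κ := TrIdx N) x.toKIdx bI) (blkBK (κ := TrIdx N) x.toKIdx bI)
          (DvcoKH x.toKIdx (trBasis N) (bg9Y (Matrix (Fin N) (Fin N) ℂ) G x) (fun U => U) U ∘ₗ
            (GcoS x.toKIdx (trBasis N) (bg9Y (Matrix (Fin N) (Fin N) ℂ) G x) (fun U => U) (GpY x.toKIdx par) U ∘ₗ
              DvscoKH x.toKIdx (trBasis N) (bg9Y (Matrix (Fin N) (Fin N) ℂ) G x) (fun U => U) U))
          (fun a a' => B₄ * Real.exp (-(δ₄ * (geo9Y x).dist a a'))) := by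
  obtain ⟨M₄, B₄, δ₄, hM₄, hB₄, hδ₄, H⟩ := blockBd_DvGcoSDvs_kIdx_par d ℓ hd hL b₀ b₁ N hκ₀ hκ₀1
  refine ⟨M₄, B₄, δ₄, hM₄, hB₄, hδ₄, ?_⟩
  intro G hG x hM par U hU hpar hinv hcoer bI hlev hβ1 R₀ H₀ _
  haveI : Nonempty (Fin N) := ⟨⟨0, Nat.pos_of_ne_zero (NeZero.ne N)⟩⟩
  letI : Fintype (geo9K x.toKIdx).Site := (inferInstance : Fintype (geo9Y x).Site)
  exact H x.toKIdx hM x.hcfk hG (bg9Y (Matrix (Fin N) (Fin N) ℂ) G x) (fun U => U) par U hU hpar hinv hcoer hlev hβ1 R₀ H₀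

end Literature.MathematicalPhysics.QuantumFieldTheory.Balaban1983to89.B9Eq346GradGpDivAtPinsL2Par

end
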